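import Mathlib
import HarnessLib
import Literature.Computability.AlgebraicComplexity.ArithCircuit
import Literature.Computability.AlgebraicComplexity.CircuitDepth
import Literature.Computability.AlgebraicComplexity.StandardFamilies
import Literature.Computability.AlgebraicComplexity.RealTauConjectureDepthFour
import Literature.Computability.AlgebraicComplexity.AndrewsForbes2022BorderComposition
import Literature.Computability.AlgebraicComplexity.DepthThreeChasmCircuits
import Literature.Computability.AlgebraicComplexity.ValiantBooleanBridge
import Literature.Computability.Complexity.Circuit
import Summits.ValiantsHypothesis.ValiantsHypothesis.Theorems.SuccinctLiftIntegerAdvice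
import Summits.ValiantsHypothesis.ValiantsHypothesis.Theorems.SuccinctLiftCircuitCodes

/-!
# Succinct lift — w9b: the description dial — its top is the constant-free notch, U is a budget gap

Route `route-ValiantsHypothesis-SuccinctLift` (lens 2: natural-proofs / succinctness axis), generation 7, second file.

With the bricks of `SuccinctLiftCircuitCodes.lean` (table circuits, code length of constant-free circuits,
constant-free normal form, the parametrised notion `PerEasySuccinctCF β Δ`):

* **`perEasyCF_iff_polySuccinct`** — at POLYNOMIAL description budget `β n c = n^c + c` succinctness is free:
  `PerEasyCF Δ ↔ PerEasySuccinctCF (fun n c => n ^ c + c) Δ` for EVERY depth function `Δ` (regime-free).  So the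
  route's `PerHardLog3CF` is the TOP notch of the description dial at `Δ₁`, and
* **`uniformityLiftLog3_iff_budgetGap`** — the uniformity wall `U = UniformityLiftLog3` (item 23652, verbatim up to
  unfolding `PerEasySuccinctCF` / `PerEasyCF`) is EXACTLY the implication from budget `n + c` to budget `n^c + c`
  inside one typed family (`uniformityLift_iff_budgetGap` for a general budget `β`);
* `exists_log_pow_le_add`, `perEasySuccinctCF_linear_of_polylog`, `perEasySuccinctCF_poly_of_linear` — the
  polylogarithmic notches (Chen–Kabanets' poly-weakly-uniform regime) sit below the route's linear notch, which sits
  below the top.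

References: Jansen–Santhanam 2011 (`JansenSanthanam2011`), Chen–Kabanets 2012 (`ChenKabanets2012`, Thm. 1.3/4.10,
Lemma 3.4: the method needs advice `2^{o(m)}`), Arora–Barak 2009 Claim 2.13, Bürgisser 2000 §1.4.
-/

namespace Summit.ValiantsHypothesis.ValiantsHypothesis.Theorems.SuccinctLift

open Literature.Computability.AlgebraicComplexity Literature.Computability.Complexity Computability
open ArithCircuit

section Dial

/-- Arithmetic: a fixed quadratic in `n², n^c` is dominated by one budget `n^k + k`. [folklore] -/
theorem exists_exp_dominating (a c d : ℕ) :
    ∃ k : ℕ, c ≤ k ∧ ∀ n : ℕ, a * (n * n + n ^ c + c + d) ^ 2 + a ≤ n ^ k + k := by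
  refine ⟨a * (c + d + 2) ^ 2 + a + 2 * (c + 2), by nlinarith, fun n => ?_⟩
  rcases Nat.lt_or_ge n 2 with hn | hn
  · have hM : n * n + n ^ c + c + d ≤ c + d + 2 := by
      interval_cases n
      · have : (0 : ℕ) ^ c ≤ 1 := by cases c <;> simp
        omega
      · simp only [one_pow, mul_one]
        omega
    calc a * (n * n + n ^ c + c + d) ^ 2 + a ≤ a * (c + d + 2) ^ 2 + a := by gcongr
      _ ≤ a * (c + d + 2) ^ 2 + a + 2 * (c + 2) := Nat.le_add_right _ _
      _ ≤ n ^ (a * (c + d + 2) ^ 2 + a + 2 * (c + 2)) + (a * (c + d + 2) ^ 2 + a + 2 * (c + 2)) :=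
          Nat.le_add_left _ _
  · have h1 : 1 ≤ n := by omega
    have hM : n * n + n ^ c + c + d ≤ (c + d + 2) * n ^ (c + 2) := by
      have e1 : n * n ≤ n ^ (c + 2) := by
        rw [← sq]; exact Nat.pow_le_pow_right h1 (by omega)
      have e2 : n ^ c ≤ n ^ (c + 2) := Nat.pow_le_pow_right h1 (by omega)
      have e3 : c + d ≤ (c + d) * n ^ (c + 2) :=
        Nat.le_mul_of_pos_right _ (pow_pos h1 _)
      nlinarith
    have hsmall : a * (c + d + 2) ^ 2 + a ≤ n ^ (a * (c + d + 2) ^ 2 + a) :=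
      (Nat.lt_two_pow_self).le.trans (Nat.pow_le_pow_left hn _)
    have hone : 1 ≤ n ^ (2 * (c + 2)) := Nat.one_le_pow _ _ h1
    calc a * (n * n + n ^ c + c + d) ^ 2 + a
        ≤ a * ((c + d + 2) * n ^ (c + 2)) ^ 2 + a := by gcongr
      _ = a * (c + d + 2) ^ 2 * n ^ (2 * (c + 2)) + a := by ring
      _ ≤ (a * (c + d + 2) ^ 2 + a) * n ^ (2 * (c + 2)) := by nlinarith
      _ ≤ n ^ (a * (c + d + 2) ^ 2 + a) * n ^ (2 * (c + 2)) := by gcongr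
      _ = n ^ (a * (c + d + 2) ^ 2 + a + 2 * (c + 2)) := by rw [← pow_add]
      _ ≤ _ := Nat.le_add_right _ _

/-- **Top of the dial (the theorem of this file).**  At polynomial description budget succinctness is
free: a constant-free family with `n^c + c` wires has a well-formed constant-free normal form whose code
word has length `poly(n)`, and every string of length `L` is `O(L)`-succinct (table circuits).
[cite: AroraBarakCC2009, Claim 2.13] -/
theorem perEasySuccinctCF_poly_of_perEasyCF {Δ : ℕ → ℕ} (h : PerEasyCF Δ) :
    PerEasySuccinctCF (fun n c => n ^ c + c) Δ := by
  obtain ⟨c, hc⟩ := h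
  obtain ⟨k, hck, hk⟩ := exists_exp_dominating 80 c 27
  refine ⟨k, fun n => ?_⟩
  obtain ⟨C, C', hC', hsc, hcomp, hpd, hes⟩ := hc n
  obtain ⟨N, hwf, hsN, hev, hpdN, hesN, hszN⟩ := exists_normalForm_signConst C hsc
  have hesC : C.edgeSize ≤ n ^ c + c := by
    rw [hC', DepthThreeChasm.edgeSize_rename, edgeSize_mapCoeff] at hes
    exact hes
  have hpdC : C.productDepth ≤ Δ n := by
    rw [hC', DepthThreeChasm.productDepth_rename, productDepth_mapCoeff] at hpd
    exact hpd
  have hNe : N.edgeSize ≤ n ^ c + c := hesN.trans hesC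
  have hL : (encodeArithCircuit (n * n) N).length ≤ 8 * (n * n + n ^ c + c + 27) ^ 2 := by
    calc (encodeArithCircuit (n * n) N).length ≤ 8 * (n * n + N.edgeSize + 27) ^ 2 :=
          length_encodeArithCircuit_le_sq N hwf hsN hszN
      _ ≤ 8 * (n * n + (n ^ c + c) + 27) ^ 2 := by gcongr
      _ = 8 * (n * n + n ^ c + c + 27) ^ 2 := by ring
  set L := (encodeArithCircuit (n * n) N).length with hLdef
  have hLw : L ≤ 2 ^ (Nat.log 2 L + 1) := (Nat.lt_pow_succ_log_self one_lt_two L).le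
  have h2w : 2 ^ (Nat.log 2 L + 1) ≤ 2 * L + 2 := by
    rcases Nat.eq_zero_or_pos L with hL0 | hLpos
    · rw [hL0]; simp
    · have := Nat.pow_log_le_self 2 hLpos.ne'
      rw [pow_succ]; omega
  obtain ⟨D, hDO, hDs, hDc⟩ := exists_tableCircuit (Nat.log 2 L + 1) (encodeArithCircuit (n * n) N)
  refine ⟨N, (N.map (Int.castRingHom ℂ)).rename ⇑(finProdFinEquiv (m := n) (n := n)).symm, rfl,
    hsN, ?_, ?_, ?_, Nat.log 2 L + 1, hLw, D, hDO, ?_, hDc⟩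
  · unfold ArithCircuit.Computes at hcomp ⊢
    rw [eval_rename_apply, eval_map_apply, hev, ← eval_map_apply, ← eval_rename_apply, ← hC']
    exact hcomp
  · rw [DepthThreeChasm.productDepth_rename, productDepth_mapCoeff]
    exact hpdN.trans hpdC
  · rw [DepthThreeChasm.edgeSize_rename, edgeSize_mapCoeff]
    exact hNe.trans (OrbitRestorationQPDepthThreeRung.vsbr_pbound_mono hck n)
  · have hkn := hk n
    show D.size ≤ n ^ k + k
    nlinarith [hDs, h2w, hL, hkn]

/-- **The top notch equals the constant-free notch**, for every depth function.
[cite: AroraBarakCC2009, Claim 2.13] -/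
theorem perEasyCF_iff_polySuccinct (Δ : ℕ → ℕ) :
    PerEasyCF Δ ↔ PerEasySuccinctCF (fun n c => n ^ c + c) Δ :=
  ⟨perEasySuccinctCF_poly_of_perEasyCF, perEasyCF_of_succinct⟩

/-- Hardness form of the top notch. [cite: AroraBarakCC2009, Claim 2.13] -/
theorem perHardCF_iff_polySuccinctHard (Δ : ℕ → ℕ) :
    ¬ PerEasyCF Δ ↔ ¬ PerEasySuccinctCF (fun n c => n ^ c + c) Δ :=
  not_congr (perEasyCF_iff_polySuccinct Δ)

/-- **The uniformity wall is a budget gap.**  For any budget `β`, "β-succinct hardness ⟹ constant-free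
hardness" is literally "β-succinct hardness ⟹ poly-succinct hardness". [cite: JansenSanthanam2011, §1] -/
theorem uniformityLift_iff_budgetGap (β : ℕ → ℕ → ℕ) (Δ : ℕ → ℕ) :
    (¬ PerEasySuccinctCF β Δ → ¬ PerEasyCF Δ) ↔
      (¬ PerEasySuccinctCF β Δ → ¬ PerEasySuccinctCF (fun n c => n ^ c + c) Δ) := by
  rw [perHardCF_iff_polySuccinctHard]

/-- Every budget below polynomial: `β n c ≤ n^{c'} + c'` for a suitable re-indexing. Then β-succinct
easiness implies constant-free easiness implies poly-succinct easiness — the dial never exceeds its top.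
[folklore] -/
theorem perEasySuccinctCF_poly_of_any {β : ℕ → ℕ → ℕ} {Δ : ℕ → ℕ} (h : PerEasySuccinctCF β Δ) :
    PerEasySuccinctCF (fun n c => n ^ c + c) Δ :=
  perEasySuccinctCF_poly_of_perEasyCF (perEasyCF_of_succinct h)

/-- Polylogarithms are eventually below the identity: `⌊log₂ n⌋^k ≤ n + K`. [folklore] -/
theorem exists_log_pow_le_add (k : ℕ) : ∃ K : ℕ, ∀ n : ℕ, Nat.log 2 n ^ k ≤ n + K := by
  have hlo := (Real.isLittleO_pow_logb_id_atTop (b := 2) (n := k)).def zero_lt_one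
  obtain ⟨a, ha⟩ := Filter.eventually_atTop.1 hlo
  refine ⟨⌈a⌉₊ ^ k, fun n => ?_⟩
  rcases lt_or_ge n ⌈a⌉₊ with hn | hn
  · have h1 : Nat.log 2 n ≤ n := Nat.log_le_self 2 n
    calc Nat.log 2 n ^ k ≤ n ^ k := Nat.pow_le_pow_left h1 k
      _ ≤ ⌈a⌉₊ ^ k := Nat.pow_le_pow_left hn.le k
      _ ≤ n + ⌈a⌉₊ ^ k := Nat.le_add_left _ _
  · have hna : a ≤ (n : ℝ) := (Nat.le_ceil a).trans (by exact_mod_cast hn)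
    have h := ha n hna
    simp only [id, one_mul, Real.norm_eq_abs] at h
    have hlog : (Nat.log 2 n : ℝ) ≤ Real.logb 2 n := by
      have := Real.natLog_le_logb n 2
      exact_mod_cast this
    have h0 : (0 : ℝ) ≤ Nat.log 2 n := Nat.cast_nonneg _
    have hpow : ((Nat.log 2 n : ℕ) : ℝ) ^ k ≤ (n : ℝ) := by
      calc ((Nat.log 2 n : ℕ) : ℝ) ^ k ≤ Real.logb 2 n ^ k := pow_le_pow_left₀ h0 hlog k
        _ ≤ |Real.logb 2 n ^ k| := le_abs_self _
        _ ≤ |(n : ℝ)| := h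
        _ = n := abs_of_nonneg (Nat.cast_nonneg _)
    have : Nat.log 2 n ^ k ≤ n := by exact_mod_cast hpow
    omega

/-- **The polylogarithmic notches lie below the linear notch** (the route's `A` sits at `β n c = n + c`):
`(log₂ n)^k`-succinct easiness implies `(n + c)`-succinct easiness. [folklore] -/
theorem perEasySuccinctCF_linear_of_polylog {Δ : ℕ → ℕ} (k : ℕ)
    (h : PerEasySuccinctCF (fun n c => Nat.log 2 n ^ k + c) Δ) :
    PerEasySuccinctCF (fun n c => n + c) Δ := by
  obtain ⟨K, hK⟩ := exists_log_pow_le_add k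
  refine perEasySuccinctCF_mono (fun c => ⟨c + K, Nat.le_add_right _ _, fun n => ?_⟩) h
  have := hK n
  show Nat.log 2 n ^ k + c ≤ n + (c + K)
  omega

/-- The linear notch lies below the top: `(n + c)`-succinct easiness implies poly-succinct easiness
(directly by monotonicity, without the normal form). [folklore] -/
theorem perEasySuccinctCF_poly_of_linear {Δ : ℕ → ℕ}
    (h : PerEasySuccinctCF (fun n c => n + c) Δ) :
    PerEasySuccinctCF (fun n c => n ^ c + c) Δ := by
  refine perEasySuccinctCF_mono (fun c => ⟨c + 1, Nat.le_succ _, fun n => ?_⟩) h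
  show n + c ≤ n ^ (c + 1) + (c + 1)
  rcases Nat.eq_zero_or_pos n with rfl | hn
  · simp
  · have : n ≤ n ^ (c + 1) := by
      calc n = n ^ 1 := (pow_one n).symm
        _ ≤ n ^ (c + 1) := Nat.pow_le_pow_right hn (by omega)
    omega

/-! ### The route's window `Δ₁ = ⌊log₂ log₂ log₂ n⌋ + 1` -/

/-- **U is a budget gap (item 23652 verbatim up to unfolding).**  The route's uniformity wall
`UniformityLiftLog3 := SuccinctPerHardLog3 → PerHardLog3CF` — whose hypothesis is
`¬ PerEasySuccinctCF (fun n c => n + c) Δ₁` and whose conclusion is `¬ PerEasyCF Δ₁`, both by `rfl` — is equivalent to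
the one-parameter statement "hardness at description budget `n + c` implies hardness at budget `n^c + c`".
[cite: JansenSanthanam2011, §1] -/
theorem uniformityLiftLog3_iff_budgetGap :
    (¬ PerEasySuccinctCF (fun n c => n + c) (fun n => Nat.log 2 (Nat.log 2 (Nat.log 2 n)) + 1) →
        ¬ PerEasyCF (fun n => Nat.log 2 (Nat.log 2 (Nat.log 2 n)) + 1)) ↔
      (¬ PerEasySuccinctCF (fun n c => n + c) (fun n => Nat.log 2 (Nat.log 2 (Nat.log 2 n)) + 1) →
        ¬ PerEasySuccinctCF (fun n c => n ^ c + c) (fun n => Nat.log 2 (Nat.log 2 (Nat.log 2 n)) + 1)) :=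
  uniformityLift_iff_budgetGap _ _

/-- The top notch at `Δ₁`: poly-succinct constant-free hardness IS constant-free hardness (`PerHardLog3CF`).
[cite: AroraBarakCC2009, Claim 2.13] -/
theorem perHardLog3CF_iff_polySuccinctHard :
    ¬ PerEasyCF (fun n => Nat.log 2 (Nat.log 2 (Nat.log 2 n)) + 1) ↔
      ¬ PerEasySuccinctCF (fun n c => n ^ c + c) (fun n => Nat.log 2 (Nat.log 2 (Nat.log 2 n)) + 1) :=
  perHardCF_iff_polySuccinctHard _

end Dial

end Summit.ValiantsHypothesis.ValiantsHypothesis.Theorems.SuccinctLift
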